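import Literature.Analysis.FunctionSpaces.HolderManifoldModelOperator
import Literature.Geometry.Lorentzian.GreenIdentityCompactSupport
import HarnessLib

/-!
# Locality of `Δ_g` on the manifold Hölder spaces: piecewise chart formula and jet continuity (Hölder spaces, part 23)

Topic `Literature/Analysis/FunctionSpaces`. For a `C²` function `u` on a manifold with Hölder chart
data `𝔄` (part 4), `u = ∑ᵢ ρᵢ u` and `Δ_g (ρᵢ u)(x)` is the chart expression of `Δ_g`
(`dalembertian_eq_coeff`, part 15) applied to the `i`-th chart piece `pieceᵢ u = (ρᵢ u) ∘ chartᵢ⁻¹`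
at `chartᵢ x` when `x ∈ sourceᵢ`, and `0` otherwise (locality of `Δ_g`,
`dalembertian_eq_zero_of_eventuallyEq_zero`). Hence

* `dalembertian_finset_sum` — `Δ_g (∑ fᵢ) = ∑ Δ_g fᵢ` at a point for `C²` summands;
* `dalembertian_eq_sum_piece` — the piecewise chart formula
  `Δ_g u (x) = ∑ᵢ 𝟙_{sourceᵢ}(x) Pᵢ(pieceᵢ u)(chartᵢ x)` with
  `Pᵢ(p)(y) = ∑_{ab} Ĝ^{ab}_i(y) D²p(y)(e_a,e_b) + ∑_l b^l_i(y) Dp(y)(e_l)`;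
* `tendsto_apply_of_tendstoUniformly_piece`, `tendsto_dalembertian_of_tendstoUniformly_piece`,
  `tendsto_modelOperator_of_tendstoUniformly_piece` — **locality of order `≤ 2`**: if the
  derivatives of order `≤ k + 2` of all chart pieces of `uₙ` converge uniformly to those of `v`,
  then `uₙ(x) → v(x)`, `Δ_g uₙ(x) → Δ_g v(x)` and `(Δ_g − 1)uₙ(x) → (Δ_g − 1)v(x)` — hypothesis (3)
  of `HolderManifoldFunction.surjective_of_estimate_of_smooth` (part 22) for `L₀ = Δ_g − 1`.

Brick of census item (2c) of `Literature.Geometry.Riemannian.gurskyViaclovsky_pathOpen_weighted_four`.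
Everything is proved; no named facts.

## References

* B. O'Neill, *Semi-Riemannian Geometry* (1983), Ch. 3, Def. 3.50. [ONeill1983]
* D. Gilbarg, N. S. Trudinger, *Elliptic Partial Differential Equations of Second Order* (2001),
  §6.1. [GilbargTrudinger2001]
-/

noncomputable section

open Set Filter Function Bundle
open scoped NNReal Topology Manifold ContDiff

namespace Literature.Analysis.FunctionSpaces

open Literature.Geometry.Lorentzian PseudoRiemannianMetric

section Locality

variable {ι : Type*} [Fintype ι] {E : Type} [NormedAddCommGroup E] [NormedSpace ℝ E]
  [FiniteDimensional ℝ E] {M : Type*} [TopologicalSpace M] [ChartedSpace E M]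
  [IsManifold 𝓘(ℝ, E) ∞ M] [CompactSpace M] (𝔄 : HolderChartData ι E M)
  {κ : Type*} [Fintype κ] [DecidableEq κ] (bE : Module.Basis κ ℝ E)
  (g : PseudoRiemannianMetric 𝓘(ℝ, E) ∞ E (TangentSpace 𝓘(ℝ, E) : M → Type _)) [g.HasLeviCivita]
  {k : ℕ} {r : ℝ≥0}

omit [Fintype ι] [CompactSpace M] in
/-- **`Δ_g` of a finite sum of `C²` functions** at a point. [cite: ONeill1983, Ch. 3, Def. 3.50] -/
theorem dalembertian_finset_sum {α : Type*} (s : Finset α) {f : α → M → ℝ}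
    (hf : ∀ a ∈ s, ContMDiff 𝓘(ℝ, E) 𝓘(ℝ, ℝ) 2 (f a)) (x : M) :
    g.dalembertian (fun y => ∑ a ∈ s, f a y) x = ∑ a ∈ s, g.dalembertian (f a) x := by
  classical
  induction s using Finset.induction_on with
  | empty =>
      simp only [Finset.sum_empty]
      exact g.dalembertian_eq_zero_of_eventuallyEq_zero EventuallyEq.rfl
  | insert a s ha ih =>
      have hfa : ContMDiff 𝓘(ℝ, E) 𝓘(ℝ, ℝ) 2 (f a) := hf a (Finset.mem_insert_self a s)
      have hfs : ∀ b ∈ s, ContMDiff 𝓘(ℝ, E) 𝓘(ℝ, ℝ) 2 (f b) := fun b hb =>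
        hf b (Finset.mem_insert_of_mem hb)
      have hsum : ContMDiff 𝓘(ℝ, E) 𝓘(ℝ, ℝ) 2 fun y => ∑ b ∈ s, f b y :=
        contMDiff_finsetSum fun b hb => hfs b hb
      have heq : (fun y => ∑ b ∈ insert a s, f b y) = f a + fun y => ∑ b ∈ s, f b y := by
        funext y
        rw [Finset.sum_insert ha]
        rfl
      rw [heq, g.dalembertian_add_of_contMDiffAt (hfa.contMDiffAt) (hsum.contMDiffAt), ih hfs,
        Finset.sum_insert ha]

omit [CompactSpace M] in
/-- **Piecewise chart formula for `Δ_g`**: for `C²` `u`,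
`Δ_g u (x) = ∑ᵢ 𝟙_{sourceᵢ}(x) · Pᵢ(pieceᵢ u)(chartᵢ x)`. [cite: ONeill1983, Ch. 3, Def. 3.50] -/
theorem dalembertian_eq_sum_piece {u : M → ℝ} (hu : ContMDiff 𝓘(ℝ, E) 𝓘(ℝ, ℝ) 2 u) (x : M) :
    g.dalembertian u x = ∑ i, (𝔄.chart i).source.indicator (fun x =>
      (∑ a, ∑ b, gramInv bE g (𝔄.center i) (𝔄.chart i x) a b *
          fderiv ℝ (fderiv ℝ (𝔄.piece u i)) (𝔄.chart i x) (bE a) (bE b)) +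
        ∑ l, firstOrderCoeff bE g (𝔄.center i) l (𝔄.chart i x) *
          fderiv ℝ (𝔄.piece u i) (𝔄.chart i x) (bE l)) x := by
  -- `u = ∑ᵢ ρᵢ u`
  have hdec : u = fun y => ∑ i, (fun i y => 𝔄.ρ i y • u y) i y := by
    funext y
    exact (𝔄.sum_smul_eq y (u y)).symm
  have hsm : ∀ i, ContMDiff 𝓘(ℝ, E) 𝓘(ℝ, ℝ) 2 fun y => 𝔄.ρ i y • u y := fun i =>
    ((𝔄.ρ i).contMDiff.of_le (WithTop.coe_le_coe.mpr le_top)).smul hu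
  conv_lhs => rw [hdec]
  rw [dalembertian_finset_sum g Finset.univ (fun i _ => hsm i) x]
  refine Finset.sum_congr rfl fun i _ => ?_
  by_cases hx : x ∈ (𝔄.chart i).source
  · rw [indicator_of_mem hx]
    refine dalembertian_eq_coeff bE g (𝔄.center i) hx (hsm i).contMDiffAt ?_
    filter_upwards [(𝔄.chart i).open_target.mem_nhds ((𝔄.chart i).map_source hx)] with y hy
    rw [𝔄.piece_apply_of_mem u hy]
    rfl
  · rw [indicator_of_notMem hx]
    refine g.dalembertian_eq_zero_of_eventuallyEq_zero ?_
    have hxρ : x ∉ tsupport (𝔄.ρ i) := fun h => hx (𝔄.isSubordinate i h)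
    filter_upwards [(isClosed_tsupport _).isOpen_compl.mem_nhds hxρ] with y hy
    rw [image_eq_zero_of_notMem_tsupport hy, zero_smul]

omit [FiniteDimensional ℝ E] [IsManifold 𝓘(ℝ, E) ∞ M] [CompactSpace M] in
/-- **Values from `0`-jets**: if the chart pieces of `uₙ` converge uniformly to those of `v`, then
`uₙ(x) → v(x)`. [folklore] -/
theorem tendsto_apply_of_tendstoUniformly_piece {F : Type*} [NormedAddCommGroup F]
    [NormedSpace ℝ F] (u : ℕ → M → F) (v : M → F)
    (h : ∀ i, TendstoUniformly (fun n => iteratedFDeriv ℝ 0 (𝔄.piece (u n) i))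
      (iteratedFDeriv ℝ 0 (𝔄.piece v i)) atTop) (x : M) :
    Tendsto (fun n => u n x) atTop (𝓝 (v x)) := by
  have heq : ∀ w : M → F, w x = ∑ i, (𝔄.chart i).source.indicator
      (fun x => iteratedFDeriv ℝ 0 (𝔄.piece w i) (𝔄.chart i x) 0) x := by
    intro w
    rw [𝔄.apply_eq_sum_indicator_piece w x]
    refine Finset.sum_congr rfl fun i _ => ?_
    by_cases hx : x ∈ (𝔄.chart i).source
    · rw [indicator_of_mem hx, indicator_of_mem hx, iteratedFDeriv_zero_apply]
    · rw [indicator_of_notMem hx, indicator_of_notMem hx]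
  rw [heq v]
  simp_rw [heq (u _)]
  refine tendsto_finsetSum _ fun i _ => ?_
  by_cases hx : x ∈ (𝔄.chart i).source
  · simp only [indicator_of_mem hx]
    exact ((continuous_eval_const (0 : Fin 0 → E)).tendsto _).comp ((h i).tendsto_at _)
  · simp only [indicator_of_notMem hx]
    exact tendsto_const_nhds

omit [CompactSpace M] in
/-- **Locality of order `≤ 2` of `Δ_g`**: if the derivatives of order `≤ 2` of all chart pieces
of the `C²` functions `uₙ` converge uniformly to those of the `C²` function `v`, then
`Δ_g uₙ(x) → Δ_g v(x)` for every `x`. [cite: GilbargTrudinger2001, §6.1] -/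
theorem tendsto_dalembertian_of_tendstoUniformly_piece (u : ℕ → M → ℝ) (v : M → ℝ)
    (hu : ∀ n, ContMDiff 𝓘(ℝ, E) 𝓘(ℝ, ℝ) 2 (u n)) (hv : ContMDiff 𝓘(ℝ, E) 𝓘(ℝ, ℝ) 2 v)
    (h1 : ∀ i, TendstoUniformly (fun n => iteratedFDeriv ℝ 1 (𝔄.piece (u n) i))
      (iteratedFDeriv ℝ 1 (𝔄.piece v i)) atTop)
    (h2 : ∀ i, TendstoUniformly (fun n => iteratedFDeriv ℝ 2 (𝔄.piece (u n) i))
      (iteratedFDeriv ℝ 2 (𝔄.piece v i)) atTop) (x : M) :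
    Tendsto (fun n => g.dalembertian (u n) x) atTop (𝓝 (g.dalembertian v x)) := by
  rw [dalembertian_eq_sum_piece 𝔄 (Module.finBasis ℝ E) g hv x]
  simp_rw [dalembertian_eq_sum_piece 𝔄 (Module.finBasis ℝ E) g (hu _) x]
  refine tendsto_finsetSum _ fun i _ => ?_
  by_cases hx : x ∈ (𝔄.chart i).source
  · simp only [indicator_of_mem hx]
    -- second and first derivatives at `y = chartᵢ x` through the iterated derivatives
    have hD2 : ∀ (w : E → ℝ) (p q : E), fderiv ℝ (fderiv ℝ w) (𝔄.chart i x) p q =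
        iteratedFDeriv ℝ 2 w (𝔄.chart i x) ![p, q] := fun w p q => by
      rw [iteratedFDeriv_two_apply]
      rfl
    have hD1 : ∀ (w : E → ℝ) (p : E), fderiv ℝ w (𝔄.chart i x) p =
        iteratedFDeriv ℝ 1 w (𝔄.chart i x) ![p] := fun w p => by
      rw [iteratedFDeriv_one_apply]
      rfl
    refine Tendsto.add (tendsto_finsetSum _ fun a _ => tendsto_finsetSum _ fun b _ => ?_)
      (tendsto_finsetSum _ fun l _ => ?_)
    · simp_rw [hD2]
      exact (((continuous_eval_const (![Module.finBasis ℝ E a, Module.finBasis ℝ E b] :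
        Fin 2 → E)).tendsto _).comp ((h2 i).tendsto_at _)).const_mul _
    · simp_rw [hD1]
      exact (((continuous_eval_const (![Module.finBasis ℝ E l] : Fin 1 → E)).tendsto _).comp
        ((h1 i).tendsto_at _)).const_mul _
  · simp only [indicator_of_notMem hx]
    exact tendsto_const_nhds

/-- **Locality of `L₀ = Δ_g − 1` on `C^{k+2,r}_𝔄(M, ℝ)`** — hypothesis (3) of
`HolderManifoldFunction.surjective_of_estimate_of_smooth` (part 22). [cite: GilbargTrudinger2001, §6.1] -/
theorem tendsto_modelOperator_of_tendstoUniformly_piece (hr : r ≤ 1)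
    (u : ℕ → HolderManifoldFunction 𝔄 ℝ (k + 2) r) (v : HolderManifoldFunction 𝔄 ℝ (k + 2) r)
    (h : ∀ (i : ι) (j : ℕ), j ≤ k + 2 →
      TendstoUniformly (fun n => iteratedFDeriv ℝ j (𝔄.piece (u n : M → ℝ) i))
        (iteratedFDeriv ℝ j (𝔄.piece (v : M → ℝ) i)) atTop) (x : M) :
    Tendsto (fun n => modelOperatorCLM (k := k) 𝔄 g hr (u n) x) atTop
      (𝓝 (modelOperatorCLM (k := k) 𝔄 g hr v x)) := by
  simp only [modelOperatorCLM_apply]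
  have h2k : (2 : WithTop ℕ∞) ≤ (k + 2 : ℕ) := by exact_mod_cast Nat.le_add_left 2 k
  refine Tendsto.sub ?_ ?_
  · exact tendsto_dalembertian_of_tendstoUniformly_piece 𝔄 g
      (fun n => (u n : M → ℝ)) v (fun n => (u n).contMDiff.of_le h2k) (v.contMDiff.of_le h2k)
      (fun i => h i 1 (by omega)) (fun i => h i 2 (by omega)) x
  · exact tendsto_apply_of_tendstoUniformly_piece 𝔄 (fun n => (u n : M → ℝ)) v
      (fun i => h i 0 (Nat.zero_le _)) x

end Locality

end Literature.Analysis.FunctionSpaces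

end
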